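import Mathlib
import Summits.Ventures.PercRepro2.OneTypedEdge
import Summits.Ventures.PercRepro2.TypedUntouched
import Summits.Ventures.PercRepro2.TypedRootPathThree

/-!
# `a₃` adjacent to both roots, one edge of type 2: every typed base vanishes (blind cell
PercRepro2, night-3 g13, 2026-08-27; `proofs/NIGHT3-CERT.md` §22.7)

Let `e = {a₁, a₃}` be a typed edge of type `2` and `f = {a₂, a₃}` a typed edge of type `1` or `2`.
In every typed triple either some copy carries both (it joins the roots through `a₃`: `Q` fails and
`K₃ = 0`), or every copy carries `e` or `f` — then `a₃ ∈ U` in every copy, `PD` fails everywhere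
and `K₃ = 0` (`KB_eq_zero_of_pdB`).  Hence `typedCount_eq_zero_of_a3_vee`; the mirror with the
type-2 edge at `a₂` is `typedCount_eq_zero_of_a3_vee'` (root symmetry).  On the ∣F∣ = 9 domain of
record this is the zero set read off 1,276 + 1,276 positive instances («a root–a₃ edge of type 2»
there, where the other root–a₃ edge is always present).
-/

namespace Summit.Ventures.PercRepro2

open UnionCluster

namespace CovForm

namespace RootPath

open OneTyped Untouched

section Main

open Classical

variable {V : Type*} {E : Type*} [Fintype E] [DecidableEq E] {R : Type*} [Field R]
variable (ends : E → Sym2 V) (o a₁ a₂ a₃ b : V)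

omit [Fintype E] [DecidableEq E] in
/-- An edge open in two copies and an edge open in one or two: some copy carries both, or every
copy carries one of them. -/
lemma both_or_cover {x y w : Config E} {e f : E}
    (he : (x e).toNat + (y e).toNat + (w e).toNat = 2)
    (hf : (x f).toNat + (y f).toNat + (w f).toNat = 1 ∨ (x f).toNat + (y f).toNat + (w f).toNat = 2) :
    ((x e = true ∧ x f = true) ∨ (y e = true ∧ y f = true) ∨ (w e = true ∧ w f = true)) ∨
    ((x e = true ∨ x f = true) ∧ (y e = true ∨ y f = true) ∧ (w e = true ∨ w f = true)) := by
  cases hxe : x e <;> cases hye : y e <;> cases hwe : w e <;> cases hxf : x f <;> cases hyf : y f <;>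
    cases hwf : w f <;> simp_all

omit [Fintype E] [DecidableEq E] in
/-- A copy carrying `e` or `f` has `a₃` in a root cluster. -/
lemma pdB_st_eq_zero_vee {e f : E} (he : ends e = s(a₁, a₃)) (hf : ends f = s(a₂, a₃))
    (u : Config E) (h : u e = true ∨ u f = true) : pdB (st ends o a₁ a₂ a₃ b u) = 0 := by
  apply pdB_eq_zero_of_L3_or_H3
  unfold st St.L3 St.H3
  rcases h with h | h
  · exact Or.inl (decide_eq_true (conn_of_openAdj ⟨e, h, he⟩))
  · exact Or.inr (decide_eq_true (conn_of_openAdj ⟨f, h, hf⟩))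

/-- **`a₃` adjacent to both roots, the `a₁`-edge of type 2, the `a₂`-edge typed: every typed base
vanishes.** -/
theorem typedCount_eq_zero_of_a3_vee {e f : E} (he : ends e = s(a₁, a₃)) (hf : ends f = s(a₂, a₃))
    (F : Finset E) (heF : e ∈ F) (hfF : f ∈ F) (z : Config E) (τ : E → ℕ) (hτe : τ e = 2)
    (hτf : τ f = 1 ∨ τ f = 2) :
    typedCount F z τ (K3 ends o a₁ a₂ a₃ b : Config E → Config E → Config E → R) = 0 := by
  rw [← typedCount_zero_kernel F z τ]
  refine typedCount_congr_on_support F z τ fun x y w _ hτ' => ?_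
  have h2e := hτ' e heF
  have h2f := hτ' f hfF
  rw [hτe] at h2e
  have hf' : (x f).toNat + (y f).toNat + (w f).toNat = 1 ∨
      (x f).toNat + (y f).toNat + (w f).toNat = 2 := by
    rcases hτf with h | h
    · exact Or.inl (h2f.trans h)
    · exact Or.inr (h2f.trans h)
  rcases both_or_cover h2e hf' with h | ⟨hx, hy, _⟩
  · exact K3_eq_zero_of_both_open ends o a₁ a₂ a₃ b he (by rw [hf, Sym2.eq_swap]) x y w h
  · rw [K3_eq_KB, KB_eq_zero_of_pdB _ _ _ (pdB_st_eq_zero_vee ends o a₁ a₂ a₃ b he hf x hx)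
      (pdB_st_eq_zero_vee ends o a₁ a₂ a₃ b he hf y hy)]
    simp

/-- The mirror: the `a₂`-edge of type 2, the `a₁`-edge typed. -/
theorem typedCount_eq_zero_of_a3_vee' {e f : E} (he : ends e = s(a₂, a₃)) (hf : ends f = s(a₁, a₃))
    (F : Finset E) (heF : e ∈ F) (hfF : f ∈ F) (z : Config E) (τ : E → ℕ) (hτe : τ e = 2)
    (hτf : τ f = 1 ∨ τ f = 2) :
    typedCount F z τ (K3 ends o a₁ a₂ a₃ b : Config E → Config E → Config E → R) = 0 := by
  rw [← SwapRoots.typedCount_swap_roots ends o a₁ a₂ a₃ b F z τ]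
  exact typedCount_eq_zero_of_a3_vee ends o a₂ a₁ a₃ b he hf F heF hfF z τ hτe hτf

end Main

end RootPath

end CovForm

end Summit.Ventures.PercRepro2
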